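import Summits.QuantumFields.YangMills.Theorems.UnitScaleTiltProp7ChartInjectivity
import Summits.QuantumFields.YangMills.Theorems.UnitScaleTiltProp7AxialReprPrint
import HarnessLib

/-!
# Route `UnitScaleTilt`, crux K1 child «MinimiserStabilityRegPr» (stmt-QuantumFields-19200), registered stub `stub_prop7From14` (skeleton birth_v7
# cc37a178…; leaf V3 «Prop 7 from a background (14)») — THE LEAF V3 FROM [Balaban1985Variational] PROPS 2, 5, 6 AT PRINT'S PRESENTATION WITH
# NO LAW LEFT AS A HYPOTHESIS: both Sect. A laws of the knit (the (4)-representative in the axial gauge (1.19); «the above mapping is one-to-one»)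
# are the theorems of `Prop7AxialReprPrint`, so `Prop7From14At L B₃ ⇐ Prop2Printed ∧ Prop5Printed ∧ Prop6Printed + capped existence leaves`
# for every presentation `S` whose `IsAxial` ∕ `Restricted` are print's (based) letters

Cell `ym3-torus` ∕ fleet seat `ym-ust-19200-p1` (gen 8; HUMAN RULING D-0037, YM ladder rung R3; director-ym 2026-08-27 20:03Z (ii)).  WHY.  The owner's
v8 re-cut of V3 along the knit (OWNER ym3-torus-plan g23, 2026-08-27 20:03Z) needs, besides the stubs P-V3-A (Prop. 2 = [Balaban1985RegularSpaces]
Thm 2 at `S₀`) and P-V3-CDE (Props 5, 6), the two Sect. A laws of `T3SectALandauChart.prop7From14At_of_props_of_located`.  Gen 7 proved `AxialRepr`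
for the comb gauge; gen 8 located that `Orbit16` is unsatisfiable and re-assembled the knit with print's laws (`Prop7ChartInjectivity`, p567142),
proved print's injectivity (`Prop7ChartInjectivityPrint`, p567484) and BOTH laws for print's letters based at the `k`-centre (`Prop7AxialReprPrint`).
THIS FILE closes the loop: (§1–§2) the knit once more, with the axial law asked only in print's regime `B₃ε₁ ≤ ε₀ ≤ e` (the v1.0 binder omitted
`B₃ε₁ ≤ ε₀`, which the p. 296 argument has in hand and the small-field construction of the (1.19)-representative needs for the background
`U₀ ∈ 𝔘_k(C₁B₃ε₁)`); (§3) the axial law with ONE threshold for the whole family of carriers of block size `L` (`e = min{1/(6C₀L³), c₂′(3,L)/(4L³)}`);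
(§4) **`prop7From14At_of_props_print`**: for every presentation `S` over `Idx L` whose `IsAxial` IS the based (1.19)-reading and whose `Restricted`
implies the based (1.29)-reading, `Prop2Printed ∧ Prop5Printed ∧ Prop6Printed` at `famLG3 L S` + the capped existence leaves ⟹
`T3Thm1CarrierNative.Prop7From14At L B₃` — V3 modulo exactly print's Props 2, 5, 6 (and the located existence leaves), no presented law.

WHAT IS PROVED (sorry-free, no definition).
§1 `atMostOneCriticalOrbit_of_props_inj'` — as `Prop7ChartInjectivity.atMostOneCriticalOrbit_of_props_inj`, the gauge-fixing law asked only for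
   `ε₀ ≤ e ∧ B₃ε₁ ≤ ε₀` (both in hand at the call site of the p. 296 argument).
§2 `gaugeFix_of_conditional_axialRepr'`, **`prop7From14At_of_props_inj'`** — the T³ knit with the axial law in print's regime and the «u = u′» law.
§3 `axialRepr_print_based_uniform` — `Prop7AxialReprPrint.exists_repr_inAx_based` wrapped with the family-uniform threshold.
§4 **`prop7From14At_of_props_print`**.

HONEST SCOPE.  Props 2, 5, 6 ([Balaban1985Variational] Prop. 2 p. 281 = [Balaban1985RegularSpaces] Thm 2; Props 5–6 pp. 294–295) and the located
existence leaves (`B11Prop7Assembly.ExistenceLeavesCap`) remain HYPOTHESES — typed statements of record at the presented family `famLG3 L S`; for the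
based letters, Thm 2 is the B8 lane's `B8Thm2SetupTorus.Thm2SetupSUAt` up to a torus translation by half a block (dictionary owed).  Count-neutral helper
toward stmt-QuantumFields-19200 (`--supports`), not a proof of the stub.

References: T. Bałaban, CMP 102 (1985) 277–309 [Balaban1985Variational] ((4) p.278, (14)–(18) p.280, Prop. 2 and «one-to-one» p.281, (122) p.296,
Prop. 7 p.299); CMP 99 (1985) 75–102 [Balaban1985RegularSpaces] ((1.14) p.78, (1.19) p.79, (1.29) p.81, Thm 2 p.83); CMP 98 (1985) 17–51
[Balaban1985Averaging] (Prop. 2 p.26, (78)–(81) p.30, (87) p.31).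
-/

noncomputable section

namespace Summit.QuantumFields.YangMills.Theorems.Prop7ChartPrint

open Literature.MathematicalPhysics.QuantumFieldTheory.Balaban1983to89
open Literature.MathematicalPhysics.QuantumFieldTheory.Balaban1983to89.T3ContinuumYM3Torus
open Literature.MathematicalPhysics.QuantumFieldTheory.Balaban1983to89.T3UnitLawDensityEML (ℰp)
open Literature.MathematicalPhysics.QuantumFieldTheory.Balaban1983to89.T3DescentFibreTower
open Literature.MathematicalPhysics.QuantumFieldTheory.Balaban1983to89.T3PrintedRegularMinimiser
open Literature.MathematicalPhysics.QuantumFieldTheory.Balaban1983to89.T3PrintedMinimiserExistence (regPr_mono)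
open Literature.MathematicalPhysics.QuantumFieldTheory.Balaban1983to89.T3PrintedRegularOrbits (descTransf gaugeAct_mem_regFibrePr_iff_of_trivial)
open B11 (VarProblemX LGData Prop2Printed Prop5Printed Prop6Printed)
open B11Prop7Assembly (Bridge ExistenceLeavesCap one_landau_of_props silent_restrictions eps2_ge_prop2 ineq122_le second_condition_auto)
open B7Prop1Explicit renaming Site → LSite
open B7Prop2Explicit (C0 c2' C0_pos c2'_pos)
open B8Eq119TwistedAxial (InAx Restr129)
open B8Thm4TorusAt (torusLam)
open B15DeterminingSets (embIter)
open B10Eq27TorusAxialLog (pull unitsField toUField)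
open B8Thm2SetupTorus (pullGauge toUGauge)
open T3Thm1Carrier
open T3Thm1CarrierNative (IsCritR2 Prop7From14At)
open T3SectALandauChart
open Summit.QuantumFields.YangMills.Theorems.Prop7ChartInjectivity (sameOrbit_of_eq_law)
open Summit.QuantumFields.YangMills.Theorems.Prop7AxialReprPrint (exists_repr_inAx_based inAk_pull_of_regPr inj16_print_based)
open Summit.QuantumFields.YangMills.Theorems.Prop7FlatHolonomy (transfUp_eq_embIter)

/-! ## §1 Clause (i) over a bridged family: the gauge-fixing law asked only in print's regime `B₃ε₁ ≤ ε₀ ≤ e` -/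

section Generic

variable {I : Type}

/-- **[Balaban1985Variational] PROPOSITION 7, CLAUSE (i), FROM PROPS 2, 5, 6 WITH PRINT'S LAWS** — as `Prop7ChartInjectivity.atMostOneCriticalOrbit_of_props_inj`,
with the p. 280 gauge-fixing law asked only for `ε₀ ≤ e` AND `B₃ε₁ ≤ ε₀` (the standing assumption of Prop. 7, p. 299 «for ε₀ ≦ a₀ and B₃ε₁ ≦ ε₀»).
[cite: Balaban1985Variational, Prop. 7 p.299, (122) p.296, Prop. 2 p.281, p.281 («The above mapping is one-to-one»)] -/
theorem atMostOneCriticalOrbit_of_props_inj' {famP : I → VarProblemX} {famD : I → LGData}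
    (β : ∀ i, Bridge (famP i) (famD i)) {B₀ B₁ B₃ C₁ c₁ e : ℝ} (he : 0 < e)
    (gaugeFix : ∀ (i : I) (ε₀ ε₁ : ℝ) (V : (famP i).Bdry) (U₀ : (famD i).Cfg) (U : (famP i).Cfg), ε₀ ≤ e → B₃ * ε₁ ≤ ε₀ →
      (famD i).Sat14 (C₁ * B₃ * ε₁) (C₁ * ε₁) ((β i).bdry V) U₀ → (famP i).InU ε₀ U → (famP i).InB V U →
        ∃ U' : (famD i).Pert, (famD i).In18 ε₀ ((β i).bdry V) U₀ U' ∧ (famP i).SameOrbit U ((β i).emb U₀ U') ∧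
          ((famP i).IsCritical V U → (famD i).Crit ((β i).bdry V) U₀ U'))
    (orbit16w : ∀ (i : I) (ε₀ : ℝ) (V : (famP i).Bdry) (U₀ : (famD i).Cfg) (U₁ : (famD i).Pert) (u u' : (famD i).GT),
      (famD i).Restricted U₀ u → (famD i).Restricted U₀ u' →
        (famD i).In18 ε₀ ((β i).bdry V) U₀ ((famD i).toAxial U₀ U₁ u) → (famD i).In18 ε₀ ((β i).bdry V) U₀ ((famD i).toAxial U₀ U₁ u') →
          (famP i).SameOrbit ((β i).emb U₀ ((famD i).toAxial U₀ U₁ u)) ((β i).emb U₀ ((famD i).toAxial U₀ U₁ u')))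
    (symm : ∀ (i : I) (U U' : (famP i).Cfg), (famP i).SameOrbit U U' → (famP i).SameOrbit U' U)
    (trans : ∀ (i : I) (U U' U'' : (famP i).Cfg), (famP i).SameOrbit U U' → (famP i).SameOrbit U' U'' → (famP i).SameOrbit U U'')
    (hB₁ : 0 < B₁) (hB₃ : 1 ≤ B₃) (hC₁ : 1 ≤ C₁) (hB₀B₁ : B₀ ≤ 4 * B₁) (hc₁ : 0 < c₁)
    (h2 : Prop2Printed B₁ B₃ C₁ c₁ famD) (h5 : Prop5Printed B₁ B₃ C₁ famD) (h6 : Prop6Printed B₀ B₃ C₁ famD) :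
    ∃ a₀ : ℝ, 0 < a₀ ∧ ∀ i : I, ∀ ε₀ ε₁ : ℝ, 0 < ε₁ → ε₀ ≤ a₀ → B₃ * ε₁ ≤ ε₀ →
      ∀ (V : (famP i).Bdry) (U₀ : (famD i).Cfg),
        (famD i).Sat14 (C₁ * B₃ * ε₁) (C₁ * ε₁) ((β i).bdry V) U₀ → (famP i).AtMostOneCriticalOrbit ε₀ V := by
  obtain ⟨c, a₄, hc, ha₄, H⟩ := one_landau_of_props B₀ B₁ B₃ C₁ c₁ famD h2 h5 h6
  have hC₁pos : 0 < C₁ := by linarith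
  set a₀ : ℝ := min e (min (a₄ / (16 * B₁ * C₁)) (min (c₁ / (2 * C₁)) (c / (8 * B₁ * C₁)))) with ha₀def
  have ha₀pos : 0 < a₀ := by
    simp only [ha₀def, lt_min_iff]
    exact ⟨he, by positivity, by positivity, by positivity⟩
  refine ⟨a₀, ha₀pos, ?_⟩
  intro i ε₀ ε₁ hε₁ hε₀a hB₃ε V U₀ h14 U U'' hU hBU hcU hU'' hBU'' hcU''
  have hε₀ : 0 < ε₀ := lt_of_lt_of_le (by nlinarith) hB₃ε
  have hεe : ε₀ ≤ e := le_trans hε₀a (min_le_left _ _)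
  have ha4 : ε₀ ≤ a₄ / (16 * B₁ * C₁) := le_trans hε₀a ((min_le_right _ _).trans (min_le_left _ _))
  have hc1 : ε₀ ≤ c₁ / (2 * C₁) := le_trans hε₀a ((min_le_right _ _).trans ((min_le_right _ _).trans (min_le_left _ _)))
  have hcc : ε₀ ≤ c / (8 * B₁ * C₁) := le_trans hε₀a ((min_le_right _ _).trans ((min_le_right _ _).trans (min_le_right _ _)))
  obtain ⟨hsum, h4c⟩ := silent_restrictions hB₁ hC₁ hB₃ hε₁.le hB₃ε hc1 hcc
  set ε₂ : ℝ := B₁ * ε₀ + B₁ * C₁ * B₃ * ε₁ with hε₂def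
  have hε₂ : B₁ * (ε₀ + C₁ * ε₁) ≤ ε₂ := eps2_ge_prop2 hB₁.le hC₁pos.le hB₃ hε₁.le
  have h8 : 8 * ε₂ ≤ a₄ := by
    have h122 := ineq122_le hB₁.le hC₁ hε₀.le hB₃ε
    have : ε₀ * (16 * B₁ * C₁) ≤ a₄ := (le_div_iff₀ (by positivity)).1 ha4
    simp only [hε₂def]; nlinarith
  have h2B : 2 * B₀ * C₁ * B₃ * ε₁ ≤ 8 * ε₂ :=
    second_condition_auto hB₁.le hC₁pos.le (by linarith) hε₀.le hε₁.le hB₀B₁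
  obtain ⟨U', hU'18, hUorb, hUcrit⟩ := gaugeFix i ε₀ ε₁ V U₀ U hεe hB₃ε h14 hU hBU
  obtain ⟨U''', hU''18, hU''orb, hU''crit⟩ := gaugeFix i ε₀ ε₁ V U₀ U'' hεe hB₃ε h14 hU'' hBU''
  obtain ⟨U₁, u, u', hu, hu', hax, hax'⟩ :=
    H i ε₀ ε₁ ε₂ hε₀ hε₁ hsum hB₃ε hε₂ h8 h2B h4c ((β i).bdry V) U₀ h14 U' U''' hU'18 (hUcrit hcU) hU''18 (hU''crit hcU'')
  have horb : (famP i).SameOrbit ((β i).emb U₀ U') ((β i).emb U₀ U''') := by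
    have := orbit16w i ε₀ V U₀ U₁ u u' hu hu' (hax.symm ▸ hU'18) (hax'.symm ▸ hU''18)
    rwa [hax, hax'] at this
  exact trans i _ _ _ hUorb (trans i _ _ _ horb (symm i _ _ hU''orb))

end Generic

/-! ## §2 At the T³ objects -/

section T3

variable {L : ℕ}

/-- The p. 280 reduction to (18) from the conditional axial-representative law in print's regime (`ε₀ ≤ e`, `B₃ε₁ ≤ ε₀`), at one member.
[cite: Balaban1985Variational, p.280 (sentence before (18)), (4)-(6) p.278] -/
theorem gaugeFix_of_conditional_axialRepr' (F : T3Family) {n K : ℕ} (h : n ≤ K) (S : Resid F n K) {C₁ B₃ e : ℝ}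
    (hax : ∀ (ε₀ ε₁ : ℝ) (V : GaugeField (F.P n) 0 (Matrix.specialUnitaryGroup (Fin 2) ℂ))
      (U₀ U : GaugeField (F.P K) 0 (Matrix.specialUnitaryGroup (Fin 2) ℂ)), ε₀ ≤ e → B₃ * ε₁ ≤ ε₀ →
      Sat14T3 F n K h (C₁ * B₃ * ε₁) (C₁ * ε₁) V U₀ → U ∈ regFibrePr F n K h ε₀ V →
        ∃ v : GaugeTransf (F.P K) 0 (Matrix.specialUnitaryGroup (Fin 2) ℂ), descTransf F n K h v = (fun _ => 1) ∧ S.IsAxial U₀ (GaugeField.gaugeAct v U))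
    (ε₀ ε₁ : ℝ) (V : GaugeField (F.P n) 0 (Matrix.specialUnitaryGroup (Fin 2) ℂ))
    (U₀ U : GaugeField (F.P K) 0 (Matrix.specialUnitaryGroup (Fin 2) ℂ)) (hεe : ε₀ ≤ e) (hB₃ε : B₃ * ε₁ ≤ ε₀)
    (h14 : (lgData3 F n K h S).Sat14 (C₁ * B₃ * ε₁) (C₁ * ε₁) V U₀)
    (hU : (varProblem3 F n K h).InU ε₀ U) (hB : (varProblem3 F n K h).InB V U) :
    ∃ U' : (lgData3 F n K h S).Pert, (lgData3 F n K h S).In18 ε₀ V U₀ U' ∧ (varProblem3 F n K h).SameOrbit U ((bridge3 F n K h S).emb U₀ U') ∧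
      ((varProblem3 F n K h).IsCritical V U → (lgData3 F n K h S).Crit V U₀ U') := by
  have hε₀ : 0 < ε₀ := pos_of_regPr F hU
  have hmem : U ∈ regFibrePr F n K h ε₀ V := (mem_regFibrePr_iff F).mpr ⟨hB, hU⟩
  obtain ⟨v, hv, hax'⟩ := hax ε₀ ε₁ V U₀ U hεe hB₃ε h14 hmem
  have hmem' : GaugeField.gaugeAct v U ∈ regFibrePr F n K h ε₀ V :=
    (gaugeAct_mem_regFibrePr_iff_of_trivial F h hε₀.le hv U V).mpr hmem
  refine ⟨pert U₀ (GaugeField.gaugeAct v U), ?_, ?_, ?_⟩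
  · show emb15 U₀ (pert U₀ (GaugeField.gaugeAct v U)) ∈ regFibrePr F n K h ε₀ V ∧
      S.IsAxial U₀ (emb15 U₀ (pert U₀ (GaugeField.gaugeAct v U)))
    rw [emb15_pert]
    exact ⟨hmem', hax'⟩
  · show T3Thm1Carrier.SameOrbit F n K h U (emb15 U₀ (pert U₀ (GaugeField.gaugeAct v U)))
    rw [emb15_pert]
    exact ⟨v, hv, rfl⟩
  · intro hcrit
    show IsCritR2 F n K h V (emb15 U₀ (pert U₀ (GaugeField.gaugeAct v U)))
    rw [emb15_pert]
    exact isCritR2_gaugeAct_of_trivial F h hv hcrit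

/-- **THE 19200 LEAF V3 FROM PROPOSITIONS 2, 5, 6 AT THE T³ OBJECTS WITH PRINT'S LAWS, v1.1** — the axial-representative law in print's regime
(`ε₀ ≤ e`, `B₃ε₁ ≤ ε₀`) and the «u = u′» injectivity law; otherwise as `Prop7ChartInjectivity.prop7From14At_of_props_inj`.
[cite: Balaban1985Variational, Prop. 7 p.299, Prop. 2 p.281, p.281 («The above mapping is one-to-one»), (122) p.296; Balaban1985RegularSpaces, p.79 (sentence after (1.20))] -/
theorem prop7From14At_of_props_inj' (hL : 1 < L) (S : ResidFam L) {B₀ B₁ B₃ c₁ O₁ O₂ e₅ e : ℝ} (he : 0 < e)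
    (hax : ∀ (i : Idx L) (ε₀ ε₁ : ℝ) (V : GaugeField (i.1.1.P i.1.2.1) 0 (Matrix.specialUnitaryGroup (Fin 2) ℂ))
      (U₀ U : GaugeField (i.1.1.P i.1.2.2) 0 (Matrix.specialUnitaryGroup (Fin 2) ℂ)), ε₀ ≤ e → B₃ * ε₁ ≤ ε₀ →
      Sat14T3 i.1.1 i.1.2.1 i.1.2.2 i.2.2.le ((L : ℝ) ^ 3 * B₃ * ε₁) ((L : ℝ) ^ 3 * ε₁) V U₀ →
      U ∈ regFibrePr i.1.1 i.1.2.1 i.1.2.2 i.2.2.le ε₀ V →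
        ∃ v : GaugeTransf (i.1.1.P i.1.2.2) 0 (Matrix.specialUnitaryGroup (Fin 2) ℂ),
          descTransf i.1.1 i.1.2.1 i.1.2.2 i.2.2.le v = (fun _ => 1) ∧ (S i).IsAxial U₀ (GaugeField.gaugeAct v U))
    (hinj : ∀ (i : Idx L) (ε₀ : ℝ) (V : GaugeField (i.1.1.P i.1.2.1) 0 (Matrix.specialUnitaryGroup (Fin 2) ℂ))
      (U₀ U₁ : GaugeField (i.1.1.P i.1.2.2) 0 (Matrix.specialUnitaryGroup (Fin 2) ℂ))
      (u u' : GaugeTransf (i.1.1.P i.1.2.2) 0 (Matrix.specialUnitaryGroup (Fin 2) ℂ)),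
      (S i).Restricted U₀ u → (S i).Restricted U₀ u' →
        GaugeField.gaugeAct u (emb15 U₀ U₁) ∈ regFibrePr i.1.1 i.1.2.1 i.1.2.2 i.2.2.le ε₀ V →
        (S i).IsAxial U₀ (GaugeField.gaugeAct u (emb15 U₀ U₁)) →
        GaugeField.gaugeAct u' (emb15 U₀ U₁) ∈ regFibrePr i.1.1 i.1.2.1 i.1.2.2 i.2.2.le ε₀ V →
        (S i).IsAxial U₀ (GaugeField.gaugeAct u' (emb15 U₀ U₁)) → u = u')
    (leaves : ∀ i : Idx L, ExistenceLeavesCap (bridgeFam3 L S i) B₀ B₃ ((L : ℝ) ^ 3) O₁ O₂ e₅)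
    (hB₀ : 0 < B₀) (hB₁ : 0 < B₁) (hB₃ : 1 ≤ B₃) (hB₀B₁ : B₀ ≤ 4 * B₁) (hc₁ : 0 < c₁) (hO₁ : 1 ≤ O₁) (hO₂ : 1 ≤ O₂) (he₅ : 0 < e₅)
    (h2 : Prop2Printed B₁ B₃ ((L : ℝ) ^ 3) c₁ (famLG3 L S)) (h5 : Prop5Printed B₁ B₃ ((L : ℝ) ^ 3) (famLG3 L S))
    (h6 : Prop6Printed B₀ B₃ ((L : ℝ) ^ 3) (famLG3 L S)) :
    Prop7From14At L B₃ := by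
  have hL1 : (1 : ℝ) ≤ (L : ℝ) := by exact_mod_cast hL.le
  have hC₁ : (1 : ℝ) ≤ (L : ℝ) ^ 3 := one_le_pow₀ hL1
  have hC₁pos : (0 : ℝ) < (L : ℝ) ^ 3 := by positivity
  obtain ⟨a₀, ha₀, HU⟩ := atMostOneCriticalOrbit_of_props_inj' (bridgeFam3 L S) he
    (fun i ε₀ ε₁ V U₀ U hεe hB₃ε h14 hU hB =>
      gaugeFix_of_conditional_axialRepr' i.1.1 i.2.2.le (S i) (hax i) ε₀ ε₁ V U₀ U hεe hB₃ε h14 hU hB)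
    (fun i ε₀ V U₀ U₁ u u' hu hu' h18 h18' => by
      show T3Thm1Carrier.SameOrbit i.1.1 i.1.2.1 i.1.2.2 i.2.2.le (emb15 U₀ (act16 U₀ u U₁)) (emb15 U₀ (act16 U₀ u' U₁))
      have h18a : emb15 U₀ (act16 U₀ u U₁) ∈ regFibrePr i.1.1 i.1.2.1 i.1.2.2 i.2.2.le ε₀ V ∧
          (S i).IsAxial U₀ (emb15 U₀ (act16 U₀ u U₁)) := h18
      have h18b : emb15 U₀ (act16 U₀ u' U₁) ∈ regFibrePr i.1.1 i.1.2.1 i.1.2.2 i.2.2.le ε₀ V ∧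
          (S i).IsAxial U₀ (emb15 U₀ (act16 U₀ u' U₁)) := h18'
      rw [emb15_act16] at h18a h18b
      rw [emb15_act16, emb15_act16]
      exact sameOrbit_of_eq_law i.1.1 i.2.2.le (S i) (hinj i) ε₀ V U₀ U₁ u u' hu hu' h18a h18b)
    (fun i _ _ hUU' => sameOrbit_symm i.1.1 i.2.2.le hUU') (fun i _ _ _ h₁ h₂ => sameOrbit_trans i.1.1 i.2.2.le h₁ h₂)
    hB₁ hB₃ hC₁ hB₀B₁ hc₁ h2 h5 h6
  obtain ⟨a₁', ha₁', HE⟩ := exists_minimalOrbit_of_prop6_cap_explicit (bridgeFam3 L S) leaves hB₀ (by linarith) hC₁pos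
    (by linarith) (by linarith) he₅ h6
  refine ⟨a₀, a₁', O₂ * O₁, ha₀, ha₁', one_le_mul_of_one_le_of_one_le hO₂ hO₁, ?_⟩
  intro i ε₀ ε₁ hε₁ V _hV U₀ hU₀ hB
  have h14 : (famLG3 L S i).Sat14 ((L : ℝ) ^ 3 * B₃ * ε₁) ((L : ℝ) ^ 3 * ε₁) ((bridgeFam3 L S i).bdry V) U₀ := by
    obtain ⟨⟨F, n, K⟩, hF, hnK⟩ := i
    exact sat14T3_of_mem_fibre (mul_pos hC₁pos hε₁) hU₀ hB
  refine ⟨fun hε₀a hB₃ε => HU i ε₀ ε₁ hε₁ hε₀a hB₃ε V U₀ h14, fun hε₁a => ?_⟩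
  obtain ⟨U, hU⟩ := HE i ε₁ hε₁ hε₁a V U₀ h14
  exact ⟨U, hU⟩

end T3

/-! ## §3 The axial-representative law for print's based letters with ONE threshold for the whole family of block size `L` -/

section Uniform

open scoped Matrix.Norms.L2Operator

/-- **THE (4)-REPRESENTATIVE IN THE AXIAL GAUGE (1.19), BASED LETTERS, FAMILY-UNIFORM THRESHOLD**: for the carriers of block size `L` and a radius cap
`C₁ ≥ 1` for the background, with `e := min{1/(6C₀(3)C₁), c₂′(3, L)/(4C₁)}` (`B7Prop2Explicit.C0`, `c2'` — the [Balaban1985Averaging] Prop. 2 window):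
every `U ∈ (6)(ε₀)`, `B₃ε₁ ≤ ε₀ ≤ e`, over `U₀` with (14) at radii `(C₁B₃ε₁, C₁ε₁)` has a (4)-image in the based (1.19)-gauge relative to `U₀`
(`Prop7AxialReprPrint.exists_repr_inAx_based`). [cite: Balaban1985RegularSpaces, p.79 (sentence after (1.20)), (1.19) p.79; Balaban1985Variational, (4) p.278, (14), (18) p.280] -/
theorem axialRepr_print_based_uniform {L : ℕ} (F : T3Family) (hF : F.L = L) {n K : ℕ} (h : n ≤ K) {C₁ : ℝ} (hC₁ : 1 ≤ C₁) (B₃ : ℝ)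
    (ε₀ ε₁ : ℝ) (V : GaugeField (F.P n) 0 (Matrix.specialUnitaryGroup (Fin 2) ℂ))
    (U₀ U : GaugeField (F.P K) 0 (Matrix.specialUnitaryGroup (Fin 2) ℂ))
    (hεe : ε₀ ≤ min (1 / (6 * C0 3 * C₁)) (c2' 3 L / (4 * C₁))) (hB₃ε : B₃ * ε₁ ≤ ε₀)
    (h14 : Sat14T3 F n K h (C₁ * B₃ * ε₁) (C₁ * ε₁) V U₀) (hU : U ∈ regFibrePr F n K h ε₀ V) :
    ∃ v : GaugeTransf (F.P K) 0 (Matrix.specialUnitaryGroup (Fin 2) ℂ), descTransf F n K h v = (fun _ => 1) ∧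
      ∀ Λ : ℕ → Set (LSite (F.P K).d), InAx (F.P K).L (K - n) Λ (pull (unitsField (toUField U₀)) (embIter (K - n) (0 : Site (F.P K) (K - n))))
        (pull (unitsField (toUField (GaugeField.gaugeAct v U))) (embIter (K - n) (0 : Site (F.P K) (K - n)))) := by
  have hd : (F.P K).d = 3 := rfl
  have hLP : (F.P K).L = L := by rw [← hF]; rfl
  have hC0 : 0 < C0 3 := C0_pos _
  have hC₁0 : 0 < C₁ := by linarith
  obtain ⟨-, hreg⟩ := (mem_regFibrePr_iff F).mp hU
  have hε₀ : 0 < ε₀ := pos_of_regPr F hreg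
  set a : ℝ := C₁ * ε₀ with ha
  have ha0 : 0 < a := by positivity
  have hεa : ε₀ ≤ a := by simp only [ha]; nlinarith
  have h₁a : C₁ * B₃ * ε₁ ≤ a := by simp only [ha]; nlinarith
  have hregU : RegPr F n K a U := regPr_mono F hεa hreg
  have hreg₀ : RegPr F n K a U₀ := regPr_mono F h₁a h14.1
  have he1 : ε₀ ≤ 1 / (6 * C0 3 * C₁) := hεe.trans (min_le_left _ _)
  have he2 : ε₀ ≤ c2' 3 L / (4 * C₁) := hεe.trans (min_le_right _ _)
  have hα3 : C0 (F.P K).d * (2 * a) ≤ 1 / 3 := by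
    rw [hd]
    have := (le_div_iff₀ (by positivity)).1 he1
    simp only [ha]; nlinarith
  have hα2 : 2 * (2 * a) ≤ c2' (F.P K).d (F.P K).L := by
    rw [hd, hLP]
    have := (le_div_iff₀ (by positivity)).1 he2
    simp only [ha]; nlinarith
  have hk : K - n ≤ (F.P K).m + (F.P K).K := by show K - n ≤ F.m + K; omega
  obtain ⟨v, hv1, hvAx⟩ := exists_repr_inAx_based (P := F.P K) (by norm_num) hk ha0 hα3 hα2 U₀ U
    (inAk_pull_of_regPr F ha0.le hreg₀) (inAk_pull_of_regPr F ha0.le hregU)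
  refine ⟨v, ?_, hvAx⟩
  funext x
  unfold descTransf
  rw [transfUp_eq_embIter]
  exact hv1 _

end Uniform

/-! ## §4 THE PAYOFF: V3 from Props 2, 5, 6 at print's based presentation, no law left as a hypothesis -/

section Payoff

open scoped Matrix.Norms.L2Operator

variable {L : ℕ}

/-- **THE 19200 LEAF V3 `Prop7From14At L B₃` FROM [Balaban1985Variational] PROPOSITIONS 2, 5, 6 (TYPED STATEMENTS OF RECORD) AND THE LOCATED
EXISTENCE LEAVES, AT PRINT'S BASED PRESENTATION — NO PRESENTED LAW.**  For a block size `L > 1` and a presentation `S` of the residual layer over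
`Idx L` whose axial gauge `(S i).IsAxial U₀ U` IS [Balaban1985RegularSpaces] (1.19) read on the pullbacks based at the `k`-centre `embIter k 0`
(`↔`) and whose `(S i).Restricted U₀ u` IMPLIES (1.29) in the same reading: `Prop2Printed B₁ B₃ L³ c₁ (famLG3 L S) ∧ Prop5Printed … ∧ Prop6Printed …`
+ `ExistenceLeavesCap` ⟹ `T3Thm1CarrierNative.Prop7From14At L B₃`.  Both Sect. A laws are supplied by `Prop7AxialReprPrint` (existence of the
(4)-representative in the regime `B₃ε₁ ≤ ε₀ ≤ e`, `e = min{1/(6C₀(3)L³), c₂′(3,L)/(4L³)}`; injectivity «u = u′»).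
[cite: Balaban1985Variational, Prop. 7 p.299, Prop. 2 p.281, Props 5-6 pp.294-295, (122) p.296; Balaban1985RegularSpaces, (1.19) p.79, (1.29) p.81, Thm 2 p.83] -/
theorem prop7From14At_of_props_print (hL : 1 < L) (S : ResidFam L) {B₀ B₁ B₃ c₁ O₁ O₂ e₅ : ℝ}
    (hSax : ∀ (i : Idx L) (U₀ U : GaugeField (i.1.1.P i.1.2.2) 0 (Matrix.specialUnitaryGroup (Fin 2) ℂ)),
      (S i).IsAxial U₀ U ↔
        InAx (i.1.1.P i.1.2.2).L (i.1.2.2 - i.1.2.1) (torusLam (i.1.2.2 - i.1.2.1))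
          (pull (unitsField (toUField U₀)) (embIter (i.1.2.2 - i.1.2.1) (0 : Site (i.1.1.P i.1.2.2) (i.1.2.2 - i.1.2.1))))
          (pull (unitsField (toUField U)) (embIter (i.1.2.2 - i.1.2.1) (0 : Site (i.1.1.P i.1.2.2) (i.1.2.2 - i.1.2.1)))))
    (hSre : ∀ (i : Idx L) (U₀ : GaugeField (i.1.1.P i.1.2.2) 0 (Matrix.specialUnitaryGroup (Fin 2) ℂ))
      (u : GaugeTransf (i.1.1.P i.1.2.2) 0 (Matrix.specialUnitaryGroup (Fin 2) ℂ)), (S i).Restricted U₀ u →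
        Restr129 (i.1.1.P i.1.2.2).L (i.1.2.2 - i.1.2.1) (torusLam (i.1.2.2 - i.1.2.1))
          (pull (unitsField (toUField U₀)) (embIter (i.1.2.2 - i.1.2.1) (0 : Site (i.1.1.P i.1.2.2) (i.1.2.2 - i.1.2.1))))
          (pullGauge (fun x => Unitary.toUnits (toUGauge (i.1.1.P i.1.2.2) 2 u x)) (embIter (i.1.2.2 - i.1.2.1) (0 : Site (i.1.1.P i.1.2.2) (i.1.2.2 - i.1.2.1)))))
    (leaves : ∀ i : Idx L, ExistenceLeavesCap (bridgeFam3 L S i) B₀ B₃ ((L : ℝ) ^ 3) O₁ O₂ e₅)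
    (hB₀ : 0 < B₀) (hB₁ : 0 < B₁) (hB₃ : 1 ≤ B₃) (hB₀B₁ : B₀ ≤ 4 * B₁) (hc₁ : 0 < c₁) (hO₁ : 1 ≤ O₁) (hO₂ : 1 ≤ O₂) (he₅ : 0 < e₅)
    (h2 : Prop2Printed B₁ B₃ ((L : ℝ) ^ 3) c₁ (famLG3 L S)) (h5 : Prop5Printed B₁ B₃ ((L : ℝ) ^ 3) (famLG3 L S))
    (h6 : Prop6Printed B₀ B₃ ((L : ℝ) ^ 3) (famLG3 L S)) :
    Prop7From14At L B₃ := by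
  have hL1 : (1 : ℝ) ≤ (L : ℝ) := by exact_mod_cast hL.le
  have hC₁ : (1 : ℝ) ≤ (L : ℝ) ^ 3 := one_le_pow₀ hL1
  have hC0 : 0 < C0 3 := C0_pos _
  have hc2 : 0 < c2' 3 L := c2'_pos _ _ hL.le
  have he : 0 < min (1 / (6 * C0 3 * (L : ℝ) ^ 3)) (c2' 3 L / (4 * (L : ℝ) ^ 3)) := lt_min (by positivity) (by positivity)
  refine prop7From14At_of_props_inj' hL S he
    (fun i ε₀ ε₁ V U₀ U hεe hB₃ε h14 hU => ?_)
    (fun i => inj16_print_based i.1.1 i.2.2.le (S i) (fun U₀ U hU => (hSax i U₀ U).1 hU) (hSre i))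
    leaves hB₀ hB₁ hB₃ hB₀B₁ hc₁ hO₁ hO₂ he₅ h2 h5 h6
  obtain ⟨v, hv, hvAx⟩ := axialRepr_print_based_uniform i.1.1 i.2.1 i.2.2.le hC₁ B₃ ε₀ ε₁ V U₀ U hεe hB₃ε h14 hU
  exact ⟨v, hv, (hSax i U₀ _).2 (hvAx _)⟩

end Payoff

end Summit.QuantumFields.YangMills.Theorems.Prop7ChartPrint

end
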